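import Mathlib.Analysis.Calculus.BumpFunction.FiniteDimension
import Mathlib.Analysis.SpecialFunctions.SmoothTransition
import Literature.Analysis.FluidPDE.CKNLocalRegularityRRS
import HarnessLib

/-!
# Cylinder cut-offs and the telescoping pressure test functions of RRS's Step 2

Analysis/FluidPDE support file (all results proved) for Step 2 of the induction in the proof of
Robinson–Rodrigo–Sadowski, *The Three-Dimensional Navier–Stokes Equations* (2016), Theorem 15.3
(the target `RRS2016.step2_force` of `CKNLocalRegularityRRS.lean`), used in
`CKNLocalRegularityRRSStep2.lean`.

RRS p. 222: "For each `k ≥ 1` we choose a cutoff function `χ_k ∈ C_c^∞(ℝ³ × (-∞, s])` with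
`0 ≤ χ_k ≤ 1`, `χ_k ≡ 1` on `Q̄_{7r_k/8}`, `supp χ_k ∩ Q̄_1 ⊂ Q̄_{r_k}`, and `|∇χ_k| ≤ 16 r_k⁻¹`"
(footnote 6: `χ_k(x, t) = χ((x - a)/r_k, (t - s)/r_k²)` for a fixed profile `χ`), and the
telescoping decomposition
`I₃ = 2 Σ_{k=1}^{n-1} ∫ p (u·∇)[(χ_k - χ_{k+1}) φ_n] + 2 ∫ p (u·∇)(χ_n φ_n)`.

* `RRS2016.cylCut z r` — the cut-off `χ_{z,r}(τ, y) = B((y - a)/r) · T((s - τ)/r²)` with a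
  Mathlib `ContDiffBump` `B` (`= 1` on `‖w‖ ≤ 7/8`, supported in `‖w‖ < 1`) and a smooth
  transition `T` (`= 1` for `σ ≤ 49/64`, `= 0` for `σ ≥ 1`); `0 ≤ χ ≤ 1`, `χ = 1` on the closed
  cylinder of radius `7r/8` below `s`, `χ(τ, y) ≠ 0 ⟹ ‖y - a‖ < r ∧ s - r² < τ`, and
  `‖∇χ‖ ≤ c_χ / r` for an absolute `c_χ` (`exists_norm_fderiv_cylCut_le`; the printed `16` is
  replaced by the unspecified bound of the chosen profile, which is all the proof uses).
* `RRS2016.cylCutN z n m` — the truncated family `χ'_m = χ_{z, r_m}` (`m ≤ n`), `0` (`m > n`).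
* `RRS2016.presTest z n φ k = (χ'_k - χ'_{k+1}) φ` — the pressure test functions, so that
  `Σ_{k=1}^{n} presTest k = χ_{r_1} φ` (`sum_presTest_eq`; for `k = n` this is `χ_n φ`).
* `RRS2016.norm_fderiv_presTest_le` — the gradient bound
  `‖∇[(χ_k - χ_{k+1}) φ](τ, ·)‖ ≤ (256 + 136 c_χ) C₁ r² r_k⁻⁴` below the top time, from the
  bounds (i)–(ii) of Lemma 15.11 for `φ = φ_{n+1}` (RRS p. 223: "the support of `χ_k - χ_{k+1}`
  is contained in `Q_{r_k} ∖ Q_{r_{k+2}}` where `|∇φ_n| ≤ C₁ r_n² r_{k+2}⁻⁴`", plus the terms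
  `φ ∇χ_k`, `φ ∇χ_{k+1}` living on the rings `k`, `k + 1`), and
  `fderiv_presTest_eq_zero_of_notMem` — `∇Φ_k(τ, ·)` vanishes off `Q_{r_k}(z)`.

## References

* J. C. Robinson, J. L. Rodrigo, W. Sadowski, *The Three-Dimensional Navier–Stokes Equations*,
  Cambridge Studies in Advanced Mathematics 157, CUP (2016), proof of Theorem 15.3, Step 2,
  pp. 221–223. [RobinsonRodrigoSadowski2016]
-/

noncomputable section

open MeasureTheory Set Function Filter Topology TopologicalSpace Metric
open scoped NNReal ENNReal InnerProductSpace RealInnerProductSpace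

namespace Literature.Analysis.FluidPDE

namespace RRS2016



/-- The space profile of the cylinder cut-offs: a smooth bump `= 1` on `‖w‖ ≤ 7/8`, supported in
`‖w‖ < 1`. [folklore] -/
def cylBump : ContDiffBump (0 : (EuclideanSpace ℝ (Fin 3))) := ⟨7 / 8, 1, by norm_num, by norm_num⟩

/-- The time profile: `T(σ) = smoothTransition((1 - σ)/(15/64))`, `= 1` for `σ ≤ 49/64`, `= 0` for
`σ ≥ 1`. [folklore] -/
def cylTime (σ : ℝ) : ℝ := Real.smoothTransition ((1 - σ) / (15 / 64))

/-- `T` is smooth. [folklore] -/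
theorem contDiff_cylTime {m : ℕ∞} : ContDiff ℝ m cylTime :=
  Real.smoothTransition.contDiff.comp ((contDiff_const.sub contDiff_id).div_const _)

/-- `T = 1` for `σ ≤ 49/64`. [folklore] -/
theorem cylTime_eq_one {σ : ℝ} (h : σ ≤ 49 / 64) : cylTime σ = 1 :=
  Real.smoothTransition.one_of_one_le (by rw [le_div_iff₀ (by norm_num)]; linarith)

/-- `T = 0` for `σ ≥ 1`. [folklore] -/
theorem cylTime_eq_zero {σ : ℝ} (h : 1 ≤ σ) : cylTime σ = 0 :=
  Real.smoothTransition.zero_of_nonpos (div_nonpos_of_nonpos_of_nonneg (by linarith) (by norm_num))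

/-- `0 ≤ T ≤ 1`. [folklore] -/
theorem cylTime_mem (σ : ℝ) : 0 ≤ cylTime σ ∧ cylTime σ ≤ 1 :=
  ⟨Real.smoothTransition.nonneg _, Real.smoothTransition.le_one _⟩

/-- **The cylinder cut-off** `χ_{z,r}(τ, y) = B((y - a)/r) · T((s - τ)/r²)` for `z = (s, a)`. [folklore] -/
def cylCut (z : ℝ × (EuclideanSpace ℝ (Fin 3))) (r : ℝ) (τ : ℝ) (y : (EuclideanSpace ℝ (Fin 3))) : ℝ :=
  cylBump (r⁻¹ • (y - z.2)) * cylTime ((z.1 - τ) / r ^ 2)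

/-- `0 ≤ χ ≤ 1`. [folklore] -/
theorem cylCut_mem (z : ℝ × (EuclideanSpace ℝ (Fin 3))) (r τ : ℝ) (y : (EuclideanSpace ℝ (Fin 3))) : 0 ≤ cylCut z r τ y ∧ cylCut z r τ y ≤ 1 :=
  ⟨mul_nonneg cylBump.nonneg (cylTime_mem _).1,
    mul_le_one₀ cylBump.le_one (cylTime_mem _).1 (cylTime_mem _).2⟩

/-- `χ` is jointly smooth (for `r ≠ 0`). [folklore] -/
theorem contDiff_cylCut (z : ℝ × (EuclideanSpace ℝ (Fin 3))) (r : ℝ) : ContDiff ℝ (⊤ : ℕ∞) (uncurry (cylCut z r)) := by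
  show ContDiff ℝ _ (fun q : ℝ × (EuclideanSpace ℝ (Fin 3)) => cylBump (r⁻¹ • (q.2 - z.2)) * cylTime ((z.1 - q.1) / r ^ 2))
  exact (cylBump.contDiff.comp ((contDiff_snd.sub contDiff_const).const_smul _)).mul
    (contDiff_cylTime.comp ((contDiff_const.sub contDiff_fst).div_const _))

/-- **Support**: `χ_{z,r}(τ, y) ≠ 0` forces `‖y - a‖ < r` and `s - r² < τ`. [folklore] -/
theorem support_cylCut {z : ℝ × (EuclideanSpace ℝ (Fin 3))} {r : ℝ} (hr : 0 < r) {τ : ℝ} {y : (EuclideanSpace ℝ (Fin 3))} (h : cylCut z r τ y ≠ 0) :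
    ‖y - z.2‖ < r ∧ z.1 - r ^ 2 < τ := by
  have h1 : cylBump (r⁻¹ • (y - z.2)) ≠ 0 := fun h0 => h (by rw [cylCut, h0, zero_mul])
  have h2 : cylTime ((z.1 - τ) / r ^ 2) ≠ 0 := fun h0 => h (by rw [cylCut, h0, mul_zero])
  constructor
  · have : r⁻¹ • (y - z.2) ∈ support (cylBump : (EuclideanSpace ℝ (Fin 3)) → ℝ) := h1
    rw [cylBump.support_eq, mem_ball, dist_zero_right, norm_smul, norm_inv, Real.norm_of_nonneg hr.le,
      inv_mul_lt_iff₀ hr] at this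
    simpa [cylBump] using this
  · have h3 : (z.1 - τ) / r ^ 2 < 1 := lt_of_not_ge fun h' => h2 (cylTime_eq_zero h')
    rw [div_lt_one (by positivity)] at h3
    linarith

/-- **`χ = 1` on the closed cylinder of radius `7r/8` below `s`**: if `‖y - a‖ ≤ 7r/8` and
`s - (7r/8)² ≤ τ` then `χ_{z,r}(τ, y) = 1`. [folklore] -/
theorem cylCut_eq_one {z : ℝ × (EuclideanSpace ℝ (Fin 3))} {r : ℝ} (hr : 0 < r) {τ : ℝ} {y : (EuclideanSpace ℝ (Fin 3))}
    (hy : ‖y - z.2‖ ≤ 7 * r / 8) (hτ : z.1 - (7 * r / 8) ^ 2 ≤ τ) : cylCut z r τ y = 1 := by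
  rw [cylCut]
  have h1 : cylBump (r⁻¹ • (y - z.2)) = 1 := by
    refine cylBump.one_of_mem_closedBall ?_
    rw [mem_closedBall, dist_zero_right, norm_smul, norm_inv, Real.norm_of_nonneg hr.le]
    show r⁻¹ * ‖y - z.2‖ ≤ 7 / 8
    rw [inv_mul_le_iff₀ hr]; linarith
  have h2 : cylTime ((z.1 - τ) / r ^ 2) = 1 := by
    refine cylTime_eq_one ?_
    rw [div_le_iff₀ (by positivity)]
    nlinarith
  rw [h1, h2, mul_one]

/-- **Gradient bound** `‖∇_y χ_{z,r}(τ, ·)(y)‖ ≤ c_χ / r` with an absolute `c_χ`. [folklore] -/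
theorem exists_norm_fderiv_cylCut_le :
    ∃ c : ℝ, 0 ≤ c ∧ ∀ (z : ℝ × (EuclideanSpace ℝ (Fin 3))) (r : ℝ), 0 < r → ∀ (τ : ℝ) (y : (EuclideanSpace ℝ (Fin 3))),
      ‖fderiv ℝ (cylCut z r τ) y‖ ≤ c / r := by
  have hc : Continuous (fderiv ℝ (cylBump : (EuclideanSpace ℝ (Fin 3)) → ℝ)) :=
    (cylBump.contDiff (n := 1)).continuous_fderiv one_ne_zero
  obtain ⟨M, hM⟩ := hc.bounded_above_of_compact_support (cylBump.hasCompactSupport.fderiv (𝕜 := ℝ))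
  have hM0 : 0 ≤ M := (norm_nonneg _).trans (hM 0)
  refine ⟨M, hM0, fun z r hr τ y => ?_⟩
  have hT := cylTime_mem ((z.1 - τ) / r ^ 2)
  -- the slice is `y ↦ T · B(r⁻¹ (y - a))`
  have hB : DifferentiableAt ℝ (fun y : (EuclideanSpace ℝ (Fin 3)) => cylBump (r⁻¹ • (y - z.2))) y := by
    have h1 : DifferentiableAt ℝ (fun y : (EuclideanSpace ℝ (Fin 3)) => r⁻¹ • (y - z.2)) y :=
      (differentiableAt_id.sub_const z.2).const_smul r⁻¹
    exact ((cylBump.contDiff (n := 1)).differentiable one_ne_zero).differentiableAt.comp y h1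
  have hslice : cylCut z r τ = fun y => cylBump (r⁻¹ • (y - z.2)) * cylTime ((z.1 - τ) / r ^ 2) := rfl
  rw [hslice, fderiv_mul_const hB]
  have hcomp : fderiv ℝ (fun y : (EuclideanSpace ℝ (Fin 3)) => cylBump (r⁻¹ • (y - z.2))) y =
      (fderiv ℝ (cylBump : (EuclideanSpace ℝ (Fin 3)) → ℝ) (r⁻¹ • (y - z.2))).comp (r⁻¹ • ContinuousLinearMap.id ℝ (EuclideanSpace ℝ (Fin 3))) := by
    have h1 : HasFDerivAt (fun y : (EuclideanSpace ℝ (Fin 3)) => r⁻¹ • (y - z.2)) (r⁻¹ • ContinuousLinearMap.id ℝ (EuclideanSpace ℝ (Fin 3))) y :=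
      ((hasFDerivAt_id y).sub_const z.2).const_smul r⁻¹
    have h2 : HasFDerivAt (cylBump : (EuclideanSpace ℝ (Fin 3)) → ℝ) (fderiv ℝ (cylBump : (EuclideanSpace ℝ (Fin 3)) → ℝ) (r⁻¹ • (y - z.2)))
        (r⁻¹ • (y - z.2)) :=
      (((cylBump.contDiff (n := 1)).differentiable one_ne_zero) _).hasFDerivAt
    exact (h2.comp y h1).fderiv
  rw [hcomp]
  calc ‖cylTime ((z.1 - τ) / r ^ 2) • (fderiv ℝ (cylBump : (EuclideanSpace ℝ (Fin 3)) → ℝ) (r⁻¹ • (y - z.2))).comp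
        (r⁻¹ • ContinuousLinearMap.id ℝ (EuclideanSpace ℝ (Fin 3)))‖
      ≤ |cylTime ((z.1 - τ) / r ^ 2)| * (‖fderiv ℝ (cylBump : (EuclideanSpace ℝ (Fin 3)) → ℝ) (r⁻¹ • (y - z.2))‖ *
          ‖r⁻¹ • ContinuousLinearMap.id ℝ (EuclideanSpace ℝ (Fin 3))‖) := by
        rw [norm_smul, Real.norm_eq_abs]
        exact mul_le_mul_of_nonneg_left (ContinuousLinearMap.opNorm_comp_le _ _) (abs_nonneg _)
    _ ≤ 1 * (M * r⁻¹) := by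
        refine mul_le_mul ?_ (mul_le_mul (hM _) ?_ (norm_nonneg _) hM0) (by positivity) zero_le_one
        · rw [abs_of_nonneg hT.1]; exact hT.2
        · rw [norm_smul, norm_inv, Real.norm_of_nonneg hr.le]
          exact mul_le_of_le_one_right (by positivity) ContinuousLinearMap.norm_id_le
    _ = M / r := by rw [one_mul, div_eq_mul_inv]


/-! ### Step 2: the telescoping pressure test functions `(χ_k - χ_{k+1}) φ` -/

section PresTest

/-- Membership in `Q_ρ(z)` for a point below the top time. [folklore] -/
theorem mk_mem_parabolicCylinder_iff {z : ℝ × EuclideanSpace ℝ (Fin 3)} {ρ τ : ℝ}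
    {y : EuclideanSpace ℝ (Fin 3)} (hτ : τ < z.1) :
    (τ, y) ∈ parabolicCylinder ρ z ↔ ‖y - z.2‖ < ρ ∧ z.1 - ρ ^ 2 < τ := by
  rw [mem_parabolicCylinder, dist_eq_norm]
  exact ⟨fun h => ⟨h.2, h.1.1⟩, fun h => ⟨⟨h.2, hτ⟩, h.1⟩⟩

/-- The slices of `χ` are differentiable. [folklore] -/
theorem differentiable_cylCut (z : ℝ × EuclideanSpace ℝ (Fin 3)) (r τ : ℝ) :
    Differentiable ℝ (cylCut z r τ) := by
  have h1 : Differentiable ℝ (fun y : EuclideanSpace ℝ (Fin 3) => r⁻¹ • (y - z.2)) := fun y =>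
    (differentiableAt_id.sub_const z.2).const_smul r⁻¹
  have hB : Differentiable ℝ (fun y : EuclideanSpace ℝ (Fin 3) => cylBump (r⁻¹ • (y - z.2))) :=
    ((cylBump.contDiff (n := 1)).differentiable one_ne_zero).comp h1
  exact hB.mul_const _

/-- `∇χ_{z,ρ}(τ, ·)(y) = 0` well inside: `‖y - a‖ < 7ρ/8` and `s - (7ρ/8)² < τ`. [folklore] -/
theorem fderiv_cylCut_eq_zero_of_inner {z : ℝ × EuclideanSpace ℝ (Fin 3)} {ρ : ℝ} (hρ : 0 < ρ)
    {τ : ℝ} {y : EuclideanSpace ℝ (Fin 3)} (hy : ‖y - z.2‖ < 7 * ρ / 8)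
    (hτ : z.1 - (7 * ρ / 8) ^ 2 < τ) : fderiv ℝ (cylCut z ρ τ) y = 0 := by
  have hev : cylCut z ρ τ =ᶠ[𝓝 y] fun _ => (1 : ℝ) := by
    have ho : IsOpen {y' : EuclideanSpace ℝ (Fin 3) | ‖y' - z.2‖ < 7 * ρ / 8} :=
      isOpen_lt (continuous_id.sub continuous_const).norm continuous_const
    filter_upwards [ho.mem_nhds hy] with y' hy'
    exact cylCut_eq_one hρ (le_of_lt hy') hτ.le
  rw [hev.fderiv_eq, fderiv_const_apply]

/-- `∇χ_{z,ρ}(τ, ·)(y) = 0` unless `‖y - a‖ < ρ` and `s - ρ² < τ` (outside, `χ(τ, ·)` has a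
minimum `0` at `y`). [folklore] -/
theorem fderiv_cylCut_eq_zero_of_outer {z : ℝ × EuclideanSpace ℝ (Fin 3)} {ρ : ℝ} (hρ : 0 < ρ)
    {τ : ℝ} {y : EuclideanSpace ℝ (Fin 3)} (h : ¬(‖y - z.2‖ < ρ ∧ z.1 - ρ ^ 2 < τ)) :
    fderiv ℝ (cylCut z ρ τ) y = 0 := by
  have h0 : cylCut z ρ τ y = 0 := by
    by_contra hne
    exact h (support_cylCut hρ hne)
  have hmin : IsLocalMin (cylCut z ρ τ) y :=
    Filter.Eventually.of_forall fun y' => by rw [h0]; exact (cylCut_mem z ρ τ y').1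
  exact hmin.fderiv_eq_zero

/-- Monotonicity in the radius: `χ_{z,ρ/2} ≤ χ_{z,ρ}`. [folklore] -/
theorem cylCut_half_le {z : ℝ × EuclideanSpace ℝ (Fin 3)} {ρ : ℝ} (hρ : 0 < ρ) (τ : ℝ)
    (y : EuclideanSpace ℝ (Fin 3)) : cylCut z (ρ / 2) τ y ≤ cylCut z ρ τ y := by
  by_cases h0 : cylCut z (ρ / 2) τ y = 0
  · rw [h0]; exact (cylCut_mem z ρ τ y).1
  · obtain ⟨h1, h2⟩ := support_cylCut (half_pos hρ) h0
    rw [cylCut_eq_one hρ (by linarith) (by nlinarith)]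
    exact (cylCut_mem z (ρ / 2) τ y).2

variable (z : ℝ × EuclideanSpace ℝ (Fin 3)) (n : ℕ)

/-- The truncated family `χ'_m = χ_{z, r_m}` for `m ≤ n` and `χ'_m = 0` for `m > n`. [folklore] -/
def cylCutN (m : ℕ) : ℝ → EuclideanSpace ℝ (Fin 3) → ℝ :=
  if m ≤ n then cylCut z (rad m) else 0

/-- **The pressure test functions** `Φ_k = (χ'_k - χ'_{k+1}) φ` of the telescoping decomposition
(RRS p. 222: `(χ_k - χ_{k+1}) φ_n` for `k < n` and `χ_n φ_n` for `k = n`). [cite: RobinsonRodrigoSadowski2016, p. 222] -/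
def presTest (φ : ℝ → EuclideanSpace ℝ (Fin 3) → ℝ) (k : ℕ) (τ : ℝ) (y : EuclideanSpace ℝ (Fin 3)) : ℝ :=
  (cylCutN z n k τ y - cylCutN z n (k + 1) τ y) * φ τ y

variable {z n}

/-- `χ'_m = χ_{z, r_m}` for `m ≤ n`. [folklore] -/
theorem cylCutN_of_le {m : ℕ} (h : m ≤ n) : cylCutN z n m = cylCut z (rad m) := if_pos h

/-- `χ'_m = 0` for `m > n`. [folklore] -/
theorem cylCutN_of_lt {m : ℕ} (h : n < m) : cylCutN z n m = 0 := if_neg (not_le.2 h)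

/-- `0 ≤ χ'_m ≤ 1`. [folklore] -/
theorem cylCutN_mem (m : ℕ) (τ : ℝ) (y : EuclideanSpace ℝ (Fin 3)) :
    0 ≤ cylCutN z n m τ y ∧ cylCutN z n m τ y ≤ 1 := by
  by_cases h : m ≤ n
  · rw [cylCutN_of_le h]; exact cylCut_mem z _ τ y
  · rw [cylCutN_of_lt (not_le.1 h)]; exact ⟨le_rfl, zero_le_one⟩

/-- `χ'_{m+1} ≤ χ'_m`. [folklore] -/
theorem cylCutN_succ_le (m : ℕ) (τ : ℝ) (y : EuclideanSpace ℝ (Fin 3)) :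
    cylCutN z n (m + 1) τ y ≤ cylCutN z n m τ y := by
  by_cases h : m + 1 ≤ n
  · rw [cylCutN_of_le h, cylCutN_of_le (by omega), rad_succ]
    exact cylCut_half_le (rad_pos m) τ y
  · rw [cylCutN_of_lt (not_le.1 h)]
    exact (cylCutN_mem m τ y).1

/-- `χ'_m` is jointly smooth. [folklore] -/
theorem contDiff_cylCutN (m : ℕ) : ContDiff ℝ (⊤ : ℕ∞) (uncurry (cylCutN z n m)) := by
  by_cases h : m ≤ n
  · rw [cylCutN_of_le h]; exact contDiff_cylCut z _
  · rw [cylCutN_of_lt (not_le.1 h)]; exact contDiff_const (c := (0 : ℝ))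

/-- The slices of `χ'_m` are differentiable. [folklore] -/
theorem differentiable_cylCutN (m : ℕ) (τ : ℝ) : Differentiable ℝ (cylCutN z n m τ) := by
  by_cases h : m ≤ n
  · rw [cylCutN_of_le h]; exact differentiable_cylCut z _ τ
  · rw [cylCutN_of_lt (not_le.1 h)]; exact differentiable_const (c := (0 : ℝ))

/-- `χ'_m(τ, y) ≠ 0` forces `m ≤ n` and `(τ, y) ∈ Q_{r_m}(z)` (below the top time). [folklore] -/
theorem mem_of_cylCutN_ne_zero {m : ℕ} {τ : ℝ} {y : EuclideanSpace ℝ (Fin 3)} (hτ : τ < z.1)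
    (h : cylCutN z n m τ y ≠ 0) : m ≤ n ∧ (τ, y) ∈ parabolicCylinder (rad m) z := by
  by_cases hm : m ≤ n
  · rw [cylCutN_of_le hm] at h
    exact ⟨hm, (mk_mem_parabolicCylinder_iff hτ).2 (support_cylCut (rad_pos m) h)⟩
  · exact absurd (by rw [cylCutN_of_lt (not_le.1 hm)]; rfl) h

/-- `∇χ'_m(τ, ·)(y) ≠ 0` forces `m ≤ n` and `(τ, y)` in the ring `Q_{r_m}(z) ∖ Q_{r_{m+1}}(z)`. [folklore] -/
theorem mem_ring_of_fderiv_cylCutN_ne_zero {m : ℕ} {τ : ℝ} {y : EuclideanSpace ℝ (Fin 3)}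
    (hτ : τ < z.1) (h : fderiv ℝ (cylCutN z n m τ) y ≠ 0) :
    m ≤ n ∧ (τ, y) ∈ parabolicCylinder (rad m) z \ parabolicCylinder (rad (m + 1)) z := by
  by_cases hm : m ≤ n
  · rw [cylCutN_of_le hm] at h
    have hr := rad_pos m
    refine ⟨hm, ?_, fun hin => h ?_⟩
    · rw [mk_mem_parabolicCylinder_iff hτ]
      by_contra hc
      exact h (fderiv_cylCut_eq_zero_of_outer hr hc)
    · rw [mk_mem_parabolicCylinder_iff hτ, rad_succ] at hin
      refine fderiv_cylCut_eq_zero_of_inner hr (by linarith [hin.1]) ?_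
      nlinarith [hin.2]
  · refine absurd ?_ h
    rw [cylCutN_of_lt (not_le.1 hm)]
    exact fderiv_const_apply 0

/-- `χ'_m(τ, y) = 1` on `Q_{r_{m+1}}(z)` for `m ≤ n` (indeed on the closed cylinder of radius
`7 r_m / 8`). [folklore] -/
theorem cylCutN_eq_one_of_mem {m : ℕ} (hm : m ≤ n) {τ : ℝ} {y : EuclideanSpace ℝ (Fin 3)}
    (hτ : τ < z.1) (h : (τ, y) ∈ parabolicCylinder (rad (m + 1)) z) : cylCutN z n m τ y = 1 := by
  rw [cylCutN_of_le hm]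
  rw [mk_mem_parabolicCylinder_iff hτ, rad_succ] at h
  have hr := rad_pos m
  exact cylCut_eq_one hr (by linarith [h.1]) (by nlinarith [h.2])

/-- Telescoping: `Σ_{k=1}^{n} (g_k - g_{k+1}) = g_1 - g_{n+1}`. [folklore] -/
theorem sum_Icc_sub_succ {M : Type*} [AddCommGroup M] (g : ℕ → M) (n : ℕ) :
    ∑ k ∈ Finset.Icc 1 n, (g k - g (k + 1)) = g 1 - g (n + 1) := by
  induction n with
  | zero => simp
  | succ n ih => rw [Finset.sum_Icc_succ_top (by omega), ih]; abel

/-- **Telescoping identity**: below the top time, `Σ_{k=1}^{n} Φ_k(τ, ·) = χ_{r_1} φ(τ, ·)`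
(`n ≥ 1`). [cite: RobinsonRodrigoSadowski2016, p. 222] -/
theorem sum_presTest_eq (hn : 1 ≤ n) (φ : ℝ → EuclideanSpace ℝ (Fin 3) → ℝ) (τ : ℝ)
    (y : EuclideanSpace ℝ (Fin 3)) :
    ∑ k ∈ Finset.Icc 1 n, presTest z n φ k τ y = cylCut z (rad 1) τ y * φ τ y := by
  simp only [presTest]
  rw [← Finset.sum_mul, sum_Icc_sub_succ (fun k => cylCutN z n k τ y) n, cylCutN_of_le hn,
    cylCutN_of_lt (Nat.lt_succ_self n)]
  simp

/-- `Φ_k` is jointly smooth when `φ` is. [folklore] -/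
theorem contDiff_presTest {φ : ℝ → EuclideanSpace ℝ (Fin 3) → ℝ} (hφ : ContDiff ℝ (⊤ : ℕ∞) (uncurry φ))
    (k : ℕ) : ContDiff ℝ (⊤ : ℕ∞) (uncurry (presTest z n φ k)) :=
  ((contDiff_cylCutN k).sub (contDiff_cylCutN (k + 1))).mul hφ

/-- The support of `Φ_k` lies in that of `φ`. [folklore] -/
theorem tsupport_presTest_subset (φ : ℝ → EuclideanSpace ℝ (Fin 3) → ℝ) (k : ℕ) :
    tsupport (uncurry (presTest z n φ k)) ⊆ tsupport (uncurry φ) := by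
  have e : uncurry (presTest z n φ k) =
      (fun w : ℝ × EuclideanSpace ℝ (Fin 3) => cylCutN z n k w.1 w.2 - cylCutN z n (k + 1) w.1 w.2) *
        uncurry φ := by
    funext w; rfl
  rw [e]
  exact tsupport_mul_subset_right

/-- `Φ_k ≥ 0` when `φ ≥ 0`. [folklore] -/
theorem presTest_nonneg {φ : ℝ → EuclideanSpace ℝ (Fin 3) → ℝ} (hφ0 : ∀ t x, 0 ≤ φ t x) (k : ℕ)
    (τ : ℝ) (y : EuclideanSpace ℝ (Fin 3)) : 0 ≤ presTest z n φ k τ y :=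
  mul_nonneg (sub_nonneg.2 (cylCutN_succ_le k τ y)) (hφ0 τ y)

/-- Below the top time, `Φ_k(τ, y) = 0` off `Q_{r_k}(z)`. [folklore] -/
theorem presTest_eq_zero_of_notMem {φ : ℝ → EuclideanSpace ℝ (Fin 3) → ℝ} {k : ℕ} {τ : ℝ}
    {y : EuclideanSpace ℝ (Fin 3)} (hτ : τ < z.1) (hw : (τ, y) ∉ parabolicCylinder (rad k) z) :
    presTest z n φ k τ y = 0 := by
  have h1 : cylCutN z n k τ y = 0 := by
    by_contra h; exact hw (mem_of_cylCutN_ne_zero hτ h).2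
  have h2 : cylCutN z n (k + 1) τ y = 0 := by
    by_contra h
    exact hw (parabolicCylinder_mono (rad_pos _).le (rad_succ_le k) z (mem_of_cylCutN_ne_zero hτ h).2)
  rw [presTest, h1, h2, sub_zero, zero_mul]

/-- Below the top time, `∇Φ_k(τ, ·)(y) = 0` off `Q_{r_k}(z)` (there `Φ_k(τ, ·) ≥ 0` has a minimum). [folklore] -/
theorem fderiv_presTest_eq_zero_of_notMem {φ : ℝ → EuclideanSpace ℝ (Fin 3) → ℝ}
    (hφ0 : ∀ t x, 0 ≤ φ t x) {k : ℕ} {τ : ℝ} {y : EuclideanSpace ℝ (Fin 3)} (hτ : τ < z.1)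
    (hw : (τ, y) ∉ parabolicCylinder (rad k) z) : fderiv ℝ (presTest z n φ k τ) y = 0 := by
  have h0 := presTest_eq_zero_of_notMem (n := n) (φ := φ) hτ hw
  have hmin : IsLocalMin (presTest z n φ k τ) y :=
    Filter.Eventually.of_forall fun y' => by rw [h0]; exact presTest_nonneg hφ0 k τ y'
  exact hmin.fderiv_eq_zero

/-- **Gradient bound for the pressure test functions** (RRS p. 223): for `1 ≤ k ≤ n`, below the
top time, `|∇[(χ_k - χ_{k+1}) φ]| ≤ (256 + 136 c_χ) C₁ r² r_k⁻⁴` (`r = r_{n+1}`), from the ring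
bounds of Lemma 15.11 for `φ = φ_{n+1}` and `|∇χ_k| ≤ c_χ / r_k`. [cite: RobinsonRodrigoSadowski2016, p. 223] -/
theorem norm_fderiv_presTest_le {k : ℕ} (hk1 : 1 ≤ k) (hkn : k ≤ n) {C₁ cχ : ℝ} (hC : 0 ≤ C₁)
    (hcχ0 : 0 ≤ cχ)
    (hcχ : ∀ ρ : ℝ, 0 < ρ → ∀ (τ : ℝ) (y : EuclideanSpace ℝ (Fin 3)), ‖fderiv ℝ (cylCut z ρ τ) y‖ ≤ cχ / ρ)
    {φ : ℝ → EuclideanSpace ℝ (Fin 3) → ℝ} (hφd : ∀ τ, Differentiable ℝ (φ τ)) (hφ0 : ∀ t x, 0 ≤ φ t x)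
    (hcore : ∀ w ∈ parabolicCylinder (rad (n + 1)) z,
      φ w.1 w.2 ≤ C₁ * (rad (n + 1))⁻¹ ∧ ‖fderiv ℝ (φ w.1) w.2‖ ≤ C₁ * ((rad (n + 1)) ^ 2)⁻¹)
    (hring : ∀ j : ℕ, 1 ≤ j → j + 1 ≤ n + 1 →
      ∀ w ∈ parabolicCylinder (rad j) z \ parabolicCylinder (rad (j + 1)) z,
        φ w.1 w.2 ≤ C₁ * (rad (n + 1)) ^ 2 * ((rad (j + 1)) ^ 3)⁻¹ ∧
          ‖fderiv ℝ (φ w.1) w.2‖ ≤ C₁ * (rad (n + 1)) ^ 2 * ((rad (j + 1)) ^ 4)⁻¹)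
    {τ : ℝ} (hτ : τ < z.1) (y : EuclideanSpace ℝ (Fin 3)) :
    ‖fderiv ℝ (presTest z n φ k τ) y‖ ≤ (256 + 136 * cχ) * C₁ * (rad (n + 1)) ^ 2 * ((rad k) ^ 4)⁻¹ := by
  set r := rad (n + 1) with hr_def
  set R := rad k with hR_def
  have hr : 0 < r := rad_pos _
  have hR : 0 < R := rad_pos _
  have hk1p := rad_pos (k + 1)
  have hk2p := rad_pos (k + 1 + 1)
  have hRk1 : rad (k + 1) = R / 2 := by rw [hR_def, rad_succ]
  have hRk2 : rad (k + 2) = R / 4 := by rw [show k + 2 = k + 1 + 1 by rfl, rad_succ, rad_succ, hR_def]; ring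
  -- the radius `r = r_{n+1}` is at most `R / 2`
  have hrR : r ≤ R / 2 := by
    rw [hr_def, ← hRk1]; exact rad_antitone (by omega)
  -- product rule
  have hφy : DifferentiableAt ℝ (φ τ) y := (hφd τ).differentiableAt
  have e : presTest z n φ k τ = fun y => (cylCutN z n k τ y - cylCutN z n (k + 1) τ y) * φ τ y := rfl
  have hprod : fderiv ℝ (fun y => (cylCutN z n k τ y - cylCutN z n (k + 1) τ y) * φ τ y) y =
      (cylCutN z n k τ y - cylCutN z n (k + 1) τ y) • fderiv ℝ (φ τ) y +
        φ τ y • (fderiv ℝ (cylCutN z n k τ) y - fderiv ℝ (cylCutN z n (k + 1) τ) y) := by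
    have h1 : HasFDerivAt (fun y => cylCutN z n k τ y - cylCutN z n (k + 1) τ y)
        (fderiv ℝ (cylCutN z n k τ) y - fderiv ℝ (cylCutN z n (k + 1) τ) y) y :=
      (differentiable_cylCutN (z := z) (n := n) k τ y).hasFDerivAt.sub
        (differentiable_cylCutN (z := z) (n := n) (k + 1) τ y).hasFDerivAt
    exact (h1.mul hφy.hasFDerivAt).fderiv
  rw [e, hprod]
  -- the three terms
  have hA : ‖(cylCutN z n k τ y - cylCutN z n (k + 1) τ y) • fderiv ℝ (φ τ) y‖ ≤ 256 * C₁ * r ^ 2 * (R ^ 4)⁻¹ := by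
    by_cases hD0 : cylCutN z n k τ y - cylCutN z n (k + 1) τ y = 0
    · rw [hD0, zero_smul, norm_zero]; positivity
    · have hle1 : |cylCutN z n k τ y - cylCutN z n (k + 1) τ y| ≤ 1 := by
        have h1 := cylCutN_mem (z := z) (n := n) k τ y
        have h2 := cylCutN_mem (z := z) (n := n) (k + 1) τ y
        rw [abs_le]; constructor <;> linarith
      -- locate the point
      have hmemR : (τ, y) ∈ parabolicCylinder R z := by
        by_contra hout
        have h1 : cylCutN z n k τ y = 0 := by
          by_contra h; exact hout (mem_of_cylCutN_ne_zero hτ h).2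
        have h2 : cylCutN z n (k + 1) τ y = 0 := by
          by_contra h
          exact hout (parabolicCylinder_mono (rad_pos _).le (rad_succ_le k) z
            (mem_of_cylCutN_ne_zero hτ h).2)
        exact hD0 (by rw [h1, h2, sub_zero])
      have hgrad : ‖fderiv ℝ (φ τ) y‖ ≤ 256 * C₁ * r ^ 2 * (R ^ 4)⁻¹ := by
        by_cases hkn' : k + 1 ≤ n
        · -- not in `Q_{r_{k+2}}`, where both cut-offs equal `1`
          have hout2 : (τ, y) ∉ parabolicCylinder (rad (k + 2)) z := by
            intro hin
            have h1 : cylCutN z n (k + 1) τ y = 1 := cylCutN_eq_one_of_mem hkn' hτ hin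
            have h2 : cylCutN z n k τ y = 1 := cylCutN_eq_one_of_mem hkn hτ
              (parabolicCylinder_mono (rad_pos _).le (rad_succ_le (k + 1)) z hin)
            exact hD0 (by rw [h1, h2, sub_self])
          by_cases hmid : (τ, y) ∈ parabolicCylinder (rad (k + 1)) z
          · have h := (hring (k + 1) (by omega) (by omega) (τ, y) ⟨hmid, hout2⟩).2
            calc ‖fderiv ℝ (φ τ) y‖ ≤ C₁ * r ^ 2 * ((rad (k + 1 + 1)) ^ 4)⁻¹ := h
              _ = 256 * C₁ * r ^ 2 * (R ^ 4)⁻¹ := by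
                  rw [show k + 1 + 1 = k + 2 by rfl, hRk2]; field_simp; ring
          · have h := (hring k hk1 (by omega) (τ, y) ⟨hmemR, hmid⟩).2
            calc ‖fderiv ℝ (φ τ) y‖ ≤ C₁ * r ^ 2 * ((rad (k + 1)) ^ 4)⁻¹ := h
              _ = 16 * C₁ * r ^ 2 * (R ^ 4)⁻¹ := by rw [hRk1]; field_simp; ring
              _ ≤ 256 * C₁ * r ^ 2 * (R ^ 4)⁻¹ := by gcongr; norm_num
        · -- `k = n`
          have hkn2 : k = n := by omega
          have hRr : R = 2 * r := by rw [hR_def, hr_def, hkn2, rad_succ]; ring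
          by_cases hmid : (τ, y) ∈ parabolicCylinder (rad (n + 1)) z
          · have h := (hcore (τ, y) hmid).2
            calc ‖fderiv ℝ (φ τ) y‖ ≤ C₁ * (r ^ 2)⁻¹ := h
              _ = 16 * C₁ * r ^ 2 * (R ^ 4)⁻¹ := by rw [hRr]; field_simp; ring
              _ ≤ 256 * C₁ * r ^ 2 * (R ^ 4)⁻¹ := by gcongr; norm_num
          · have h := (hring n (by omega) le_rfl (τ, y) ⟨by rw [← hkn2]; exact hmemR, hmid⟩).2
            calc ‖fderiv ℝ (φ τ) y‖ ≤ C₁ * r ^ 2 * (r ^ 4)⁻¹ := h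
              _ = 16 * C₁ * r ^ 2 * (R ^ 4)⁻¹ := by rw [hRr]; field_simp; ring
              _ ≤ 256 * C₁ * r ^ 2 * (R ^ 4)⁻¹ := by gcongr; norm_num
      calc ‖(cylCutN z n k τ y - cylCutN z n (k + 1) τ y) • fderiv ℝ (φ τ) y‖
          = |cylCutN z n k τ y - cylCutN z n (k + 1) τ y| * ‖fderiv ℝ (φ τ) y‖ := by
            rw [norm_smul, Real.norm_eq_abs]
        _ ≤ 1 * (256 * C₁ * r ^ 2 * (R ^ 4)⁻¹) :=
            mul_le_mul hle1 hgrad (norm_nonneg _) zero_le_one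
        _ = _ := one_mul _
  have hB : φ τ y * ‖fderiv ℝ (cylCutN z n k τ) y‖ ≤ 8 * cχ * C₁ * r ^ 2 * (R ^ 4)⁻¹ := by
    by_cases h0 : fderiv ℝ (cylCutN z n k τ) y = 0
    · rw [h0, norm_zero, mul_zero]; positivity
    · obtain ⟨-, hringk⟩ := mem_ring_of_fderiv_cylCutN_ne_zero hτ h0
      have hφ := (hring k hk1 (by omega) (τ, y) hringk).1
      have hχ : ‖fderiv ℝ (cylCutN z n k τ) y‖ ≤ cχ / R := by
        rw [cylCutN_of_le hkn]; exact hcχ R hR τ y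
      calc φ τ y * ‖fderiv ℝ (cylCutN z n k τ) y‖
          ≤ (C₁ * r ^ 2 * ((rad (k + 1)) ^ 3)⁻¹) * (cχ / R) :=
            mul_le_mul hφ hχ (norm_nonneg _) (by positivity)
        _ = 8 * cχ * C₁ * r ^ 2 * (R ^ 4)⁻¹ := by rw [hRk1]; field_simp; ring
  have hC' : φ τ y * ‖fderiv ℝ (cylCutN z n (k + 1) τ) y‖ ≤ 128 * cχ * C₁ * r ^ 2 * (R ^ 4)⁻¹ := by
    by_cases h0 : fderiv ℝ (cylCutN z n (k + 1) τ) y = 0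
    · rw [h0, norm_zero, mul_zero]; positivity
    · obtain ⟨hk1n, hringk⟩ := mem_ring_of_fderiv_cylCutN_ne_zero hτ h0
      have hφ := (hring (k + 1) (by omega) (by omega) (τ, y) hringk).1
      have hχ : ‖fderiv ℝ (cylCutN z n (k + 1) τ) y‖ ≤ cχ / (R / 2) := by
        rw [cylCutN_of_le hk1n, hRk1]; exact hcχ (R / 2) (by positivity) τ y
      calc φ τ y * ‖fderiv ℝ (cylCutN z n (k + 1) τ) y‖
          ≤ (C₁ * r ^ 2 * ((rad (k + 1 + 1)) ^ 3)⁻¹) * (cχ / (R / 2)) :=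
            mul_le_mul hφ hχ (norm_nonneg _) (by positivity)
        _ = 128 * cχ * C₁ * r ^ 2 * (R ^ 4)⁻¹ := by
            rw [show k + 1 + 1 = k + 2 by rfl, hRk2]; field_simp; ring
  calc ‖(cylCutN z n k τ y - cylCutN z n (k + 1) τ y) • fderiv ℝ (φ τ) y +
        φ τ y • (fderiv ℝ (cylCutN z n k τ) y - fderiv ℝ (cylCutN z n (k + 1) τ) y)‖
      ≤ ‖(cylCutN z n k τ y - cylCutN z n (k + 1) τ y) • fderiv ℝ (φ τ) y‖ +
          ‖φ τ y • (fderiv ℝ (cylCutN z n k τ) y - fderiv ℝ (cylCutN z n (k + 1) τ) y)‖ :=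
        norm_add_le _ _
    _ ≤ 256 * C₁ * r ^ 2 * (R ^ 4)⁻¹ +
          (φ τ y * ‖fderiv ℝ (cylCutN z n k τ) y‖ + φ τ y * ‖fderiv ℝ (cylCutN z n (k + 1) τ) y‖) := by
        refine add_le_add hA ?_
        rw [norm_smul, Real.norm_of_nonneg (hφ0 τ y), ← mul_add]
        exact mul_le_mul_of_nonneg_left (norm_sub_le _ _) (hφ0 τ y)
    _ ≤ 256 * C₁ * r ^ 2 * (R ^ 4)⁻¹ +
          (8 * cχ * C₁ * r ^ 2 * (R ^ 4)⁻¹ + 128 * cχ * C₁ * r ^ 2 * (R ^ 4)⁻¹) := by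
        gcongr
    _ = (256 + 136 * cχ) * C₁ * r ^ 2 * (R ^ 4)⁻¹ := by ring

end PresTest

end RRS2016

end Literature.Analysis.FluidPDE
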